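import Literature.MathematicalPhysics.QuantumLattice.TypeClassSidecarReaderAllTori
import Literature.MathematicalPhysics.QuantumLattice.HubbardTorusTTPrimeMarkovPressureClusterBound
import HarnessLib

/-!
# Kernel reader for «c2-sector» sidecars in the `t–t'` model (cuprate box): temperature-axis windows for every torus limit

Family `hubbard` (topic `MathematicalPhysics/QuantumLattice`). The `t' = 0` readers (`TypeClassSidecarReader(.AllTori)`) combine a
checked «c2-sector» sidecar at `β` with a C1 rectangle certificate at `β_h`/`β_c`. Both ingredients exist for `t' ≠ 0`: the all-tori
type-class floor `eventually_typeFreeEntropy_mul_sq_le_log_partitionFn_allTori` is stated for the `t–t'` open box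
`hubbardOpenBoxTT' a b t t' U`, and the `t–t'` Markov ceiling `eventually_log_partitionFn_sectorHamiltonianTT'_le_of_clusterCertificateTT'`
(`HubbardTorusTTPrimeMarkovPressureClusterBound.lean`) reads a C1 certificate whose corner representative carries the two DIAGONAL bonds of
the corner block (`cornerEnergyRepTT'`). This file is the `t–t'` reader a cuprate-box (`t' = −1/4`) temperature-axis row applies:

* `IsTorusLimitOfMixture.meanEnergy_hubbardTTPrime_le_of_c2Check_of_rectMarkovCertificateTT'_allTori`: sidecar at `β` (check + claim node
  on the `t–t'` box + density `n (q a b) = 2 A₀`) + C1 on `rectWindow a' b'` at `(β_h, μ)` with `cornerEnergyRepTT'` ⇒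
  `e_Φ(ω) ≤ ((c − β_h μ n) − Wnum/Wden)/(β − β_h)` for EVERY torus limit of the canonical sector Gibbs states of the `t–t'` model;
* `…le_meanEnergy_hubbardTTPrime_of_c2Check_of_rectMarkovCertificateTT'_allTori`: the lower-edge twin (C1 at `β_c > β`).

[cite: Ruelle1969, §3.3] [cite: CoverThomas2006, Theorem 11.1.3] [cite: Israel1979, Lemma II.3.1] [cite: PoulinHastings2011, eqs. (3)–(8)]
[cite: XuEtAl2024, eq. (1)] (the `t–t'` model). Everything is PROVED; no definition, no named fact.
-/

noncomputable section

namespace Literature.MathematicalPhysics.QuantumLattice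

open Matrix Finset HubbardWave0 ThermodynamicLimit LiebThm1 AndersonCluster Literature.Probability.LatticeModels
open _root_.Filter
open scoped _root_.Topology ComplexOrder BigOperators

namespace InfVolFermionState

variable {t t' U n β : ℝ} {ω : InfVolFermionState 2} {Ls : ℕ → ℕ}

/-- **Upper edge in the `t–t'` model, every sequence of tori.** `ω` a torus limit of the canonical sector Gibbs states of the
`t–t'` Hubbard model at `β` along any `Ls → ∞` (`0 ≤ n ≤ 2`); sidecar `rows` for the open `a × b` box of the `t–t'` model passing
`c2Check P K q A₀ a b rows Wnum Wden`, density `n (q a b) = 2 A₀`, claim node `∀ r ∈ rows, zn_r/2^ze_r ≤ Re Z_β(H^open,tt'_{a×b}; r)`;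
C1 data on `rectWindow a' b'` (`a', b' ≥ 2`) at `(β_h, μ)`, `0 < β_h < β`, with the `t–t'` corner representative. Then
`e_Φ(ω) ≤ ((c − β_h μ n) − Wnum/Wden)/(β − β_h)`.
[cite: Israel1979, Lemma II.3.1] [cite: PoulinHastings2011, eqs. (3)–(8)] [cite: Ruelle1969, §3.3] [cite: XuEtAl2024, eq. (1)] -/
theorem IsTorusLimitOfMixture.meanEnergy_hubbardTTPrime_le_of_c2Check_of_rectMarkovCertificateTT'_allTori
    (hn0 : 0 ≤ n) (hn2 : n ≤ 2)
    (h : ω.IsTorusLimitOfMixture (sectorGibbsCount n) (fun L => sectorGibbsWeightTT' β t t' U n L)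
      (fun L => sectorGibbsVectorTT' t t' U n L) Ls)
    (hLs : Tendsto Ls atTop atTop) {βh : ℝ} (hβh : 0 < βh) (hlt : βh < β)
    -- C2 sidecar at `β`
    {a b : ℕ} (ha : 1 ≤ a) (hb : 1 ≤ b) {rows : List C2Row} {P K q A₀ : ℕ} {Wnum : ℤ} {Wden : ℕ}
    (hcheck : c2Check P K q A₀ a b rows Wnum Wden = true) (hn : n * ((q : ℝ) * a * b) = 2 * A₀)
    (hnode : ∀ r ∈ rows, r.floor ≤ (partitionFn β (spinSectorHamiltonian r.nu r.nd (hubbardOpenBoxTT' a b t t' U))).re)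
    -- C1 at `βh`
    (μ : ℝ) {a' b' : ℕ} (ha' : 2 ≤ a') (hb' : 2 ≤ b')
    {ι : Type*} (sι : Finset ι) (Sw : ι → Finset (Site 2)) (hS : ∀ i, Sw i ⊆ rectWindow a' b') (zw : ι → Site 2)
    (hzw : ∀ i, shiftSet (zw i) (Sw i) ⊆ rectWindow a' b') {O : ∀ i, FermionOp (Sw i)}
    (hO : ∀ i ∈ sι, (O i).IsHermitian) (g : ι → ℝ)
    {LB : FermionOp ((rectWindow a' b').erase (mkSite2 (a' - 1) (b' - 1)))} (hLB : LB.IsHermitian) {c : ℝ}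
    (hcert : ((Real.exp c : ℂ) • cfc Real.exp LB -
      fermionPartialTrace (PolySite.incl (Finset.erase_subset (mkSite2 (a' - 1) (b' - 1)) (rectWindow a' b')))
        (cfc Real.exp (-((βh : ℂ) • (cornerEnergyRepTT' (rectWindow a' b') (mkSite2 (a' - 1) (b' - 1)) t t' U μ +
            windowAnnihilator sι (rectWindow a' b') Sw hS zw hzw O g)) +
          fermionEmbed (PolySite.incl (Finset.erase_subset (mkSite2 (a' - 1) (b' - 1)) (rectWindow a' b'))) LB))).PosSemidef) :
    ω.meanEnergy (hubbardTTPrimeFermionInteraction t t' U) 1 ≤ ((c - βh * μ * n) - (Wnum : ℝ) / Wden) / (β - βh) := by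
  obtain ⟨hnd, hq, hmS, hsum, hA, hB, hz0, harith⟩ := c2Check_sound hcheck ha hb
  have hz := c2Floor_le_of_rows hnd
    (F := fun s => (partitionFn β (spinSectorHamiltonian s.1 s.2 (hubbardOpenBoxTT' a b t t' U))).re)
    (fun r hr => hnode r hr)
  have hβ : 0 ≤ β := (hβh.trans hlt).le
  have hAc := rectCorner_mem_rectWindow (a := a') (b := b') (by omega) (by omega)
  have hmain := h.meanEnergy_hubbardTTPrime_le_of_eventually_pressure_bounds hn0 hn2 hLs hβh hlt
    (fun ε hε => eventually_typeFreeEntropy_mul_sq_le_log_partitionFn_allTori t t' U n hβ ha hb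
      (c2Sectors rows) (c2Type rows) hq hmS hsum hA hB hn hn2 hz0 hz hLs hε)
    (fun ε hε => eventually_log_partitionFn_sectorHamiltonianTT'_le_of_clusterCertificateTT' t t' U μ βh hn0 hn2 hLs
      hAc toLex_le_toLex_rectCorner (rectWindow_subset_halfOpenBox_max a' b')
      (fun i => bondWeightSum_cornerBondWeight hAc (rectCorner_sub_unitVec_mem_rectWindow ha' hb' i))
      (diagBondWeightSum_cornerDiagBondWeight hAc (rectCorner_sub_unitVec_mem_rectWindow ha' hb' 0)
        (rectCorner_sub_unitVec_mem_rectWindow ha' hb' 1) (rectCorner_sub_unitVec_sub_unitVec_mem_rectWindow ha' hb'))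
      (siteWeightSum_cornerSiteWeight hAc) (siteWeightSum_mul_cornerSiteWeight hAc (-μ))
      (isHermitian_windowAnnihilator sι _ Sw hS zw hzw hO g)
      (fun L _ hL3 hℓL => trace_window_mul_windowAnnihilator
        (relabel_translate_gibbsDensity L (relabel_translate_hubbardTorusTT'_sub_mu (L := L) t t' U μ) βh)
        _ sι Sw hS zw hzw O g) hLB hcert hε)
  refine hmain.trans (div_le_div_of_nonneg_right ?_ (by linarith))
  linarith

/-- **Lower edge in the `t–t'` model, every sequence of tori** (same data, C1 at `(β_c, μ)` with `β_c > β > 0`):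
`(Wnum/Wden − (c − β_c μ n))/(β_c − β) ≤ e_Φ(ω)`.
[cite: Israel1979, Lemma II.3.1] [cite: PoulinHastings2011, eqs. (3)–(8)] [cite: Ruelle1969, §3.3] [cite: XuEtAl2024, eq. (1)] -/
theorem IsTorusLimitOfMixture.le_meanEnergy_hubbardTTPrime_of_c2Check_of_rectMarkovCertificateTT'_allTori
    (hn0 : 0 ≤ n) (hn2 : n ≤ 2)
    (h : ω.IsTorusLimitOfMixture (sectorGibbsCount n) (fun L => sectorGibbsWeightTT' β t t' U n L)
      (fun L => sectorGibbsVectorTT' t t' U n L) Ls)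
    (hLs : Tendsto Ls atTop atTop) (hβ : 0 < β) {βc : ℝ} (hlt : β < βc)
    -- C2 sidecar at `β`
    {a b : ℕ} (ha : 1 ≤ a) (hb : 1 ≤ b) {rows : List C2Row} {P K q A₀ : ℕ} {Wnum : ℤ} {Wden : ℕ}
    (hcheck : c2Check P K q A₀ a b rows Wnum Wden = true) (hn : n * ((q : ℝ) * a * b) = 2 * A₀)
    (hnode : ∀ r ∈ rows, r.floor ≤ (partitionFn β (spinSectorHamiltonian r.nu r.nd (hubbardOpenBoxTT' a b t t' U))).re)
    -- C1 at `βc`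
    (μ : ℝ) {a' b' : ℕ} (ha' : 2 ≤ a') (hb' : 2 ≤ b')
    {ι : Type*} (sι : Finset ι) (Sw : ι → Finset (Site 2)) (hS : ∀ i, Sw i ⊆ rectWindow a' b') (zw : ι → Site 2)
    (hzw : ∀ i, shiftSet (zw i) (Sw i) ⊆ rectWindow a' b') {O : ∀ i, FermionOp (Sw i)}
    (hO : ∀ i ∈ sι, (O i).IsHermitian) (g : ι → ℝ)
    {LB : FermionOp ((rectWindow a' b').erase (mkSite2 (a' - 1) (b' - 1)))} (hLB : LB.IsHermitian) {c : ℝ}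
    (hcert : ((Real.exp c : ℂ) • cfc Real.exp LB -
      fermionPartialTrace (PolySite.incl (Finset.erase_subset (mkSite2 (a' - 1) (b' - 1)) (rectWindow a' b')))
        (cfc Real.exp (-((βc : ℂ) • (cornerEnergyRepTT' (rectWindow a' b') (mkSite2 (a' - 1) (b' - 1)) t t' U μ +
            windowAnnihilator sι (rectWindow a' b') Sw hS zw hzw O g)) +
          fermionEmbed (PolySite.incl (Finset.erase_subset (mkSite2 (a' - 1) (b' - 1)) (rectWindow a' b'))) LB))).PosSemidef) :
    ((Wnum : ℝ) / Wden - (c - βc * μ * n)) / (βc - β) ≤ ω.meanEnergy (hubbardTTPrimeFermionInteraction t t' U) 1 := by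
  obtain ⟨hnd, hq, hmS, hsum, hA, hB, hz0, harith⟩ := c2Check_sound hcheck ha hb
  have hz := c2Floor_le_of_rows hnd
    (F := fun s => (partitionFn β (spinSectorHamiltonian s.1 s.2 (hubbardOpenBoxTT' a b t t' U))).re)
    (fun r hr => hnode r hr)
  have hAc := rectCorner_mem_rectWindow (a := a') (b := b') (by omega) (by omega)
  have hmain := h.le_meanEnergy_hubbardTTPrime_of_eventually_pressure_bounds hn0 hn2 hLs hβ hlt
    (fun ε hε => eventually_typeFreeEntropy_mul_sq_le_log_partitionFn_allTori t t' U n hβ.le ha hb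
      (c2Sectors rows) (c2Type rows) hq hmS hsum hA hB hn hn2 hz0 hz hLs hε)
    (fun ε hε => eventually_log_partitionFn_sectorHamiltonianTT'_le_of_clusterCertificateTT' t t' U μ βc hn0 hn2 hLs
      hAc toLex_le_toLex_rectCorner (rectWindow_subset_halfOpenBox_max a' b')
      (fun i => bondWeightSum_cornerBondWeight hAc (rectCorner_sub_unitVec_mem_rectWindow ha' hb' i))
      (diagBondWeightSum_cornerDiagBondWeight hAc (rectCorner_sub_unitVec_mem_rectWindow ha' hb' 0)
        (rectCorner_sub_unitVec_mem_rectWindow ha' hb' 1) (rectCorner_sub_unitVec_sub_unitVec_mem_rectWindow ha' hb'))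
      (siteWeightSum_cornerSiteWeight hAc) (siteWeightSum_mul_cornerSiteWeight hAc (-μ))
      (isHermitian_windowAnnihilator sι _ Sw hS zw hzw hO g)
      (fun L _ hL3 hℓL => trace_window_mul_windowAnnihilator
        (relabel_translate_gibbsDensity L (relabel_translate_hubbardTorusTT'_sub_mu (L := L) t t' U μ) βc)
        _ sι Sw hS zw hzw O g) hLB hcert hε)
  refine le_trans (div_le_div_of_nonneg_right ?_ (by linarith)) hmain
  linarith

/-- `2 log 2 + (log 3)/2 + 1/98 ≤ log 7` (re-derived; private in `TorusSectorGibbsMixture` §6). [folklore] -/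
private theorem two_mul_log_two_add_half_log_three_add_le_log_seven'' :
    2 * Real.log 2 + Real.log 3 / 2 + 1 / 98 ≤ Real.log 7 := by
  have h49 : Real.log 49 = 2 * Real.log 7 := by
    rw [show (49 : ℝ) = 7 ^ 2 by norm_num, Real.log_pow]; norm_num
  have h48 : Real.log 48 = 4 * Real.log 2 + Real.log 3 := by
    rw [show (48 : ℝ) = 2 ^ 4 * 3 by norm_num, Real.log_mul (by norm_num) (by norm_num), Real.log_pow]
    norm_num
  have hq : 1 - (49 / 48 : ℝ)⁻¹ ≤ Real.log (49 / 48) := Real.one_sub_inv_le_log_of_pos (by norm_num)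
  have hdiv : Real.log (49 / 48) = Real.log 49 - Real.log 48 :=
    Real.log_div (by norm_num) (by norm_num)
  rw [hdiv, h49, h48] at hq
  norm_num at hq
  linarith

/-- `2·H_b((7/8)/2) < 1371/1000` (re-derived; private in `TorusSectorGibbsMixture` §6). [folklore] -/
private theorem two_mul_binEntropy_half_seven_div_eight_lt' :
    2 * Real.binEntropy (7 / 8 / 2) < 1371 / 1000 := by
  rw [show (7 / 8 / 2 : ℝ) = 7 / 16 by norm_num]
  have hid : 2 * Real.binEntropy (7 / 16) =
      8 * Real.log 2 - 7 / 8 * Real.log 7 - 9 / 4 * Real.log 3 := by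
    have h16 : Real.log 16 = 4 * Real.log 2 := by
      rw [show (16 : ℝ) = 2 ^ 4 by norm_num, Real.log_pow]; norm_num
    have h9 : Real.log 9 = 2 * Real.log 3 := by
      rw [show (9 : ℝ) = 3 ^ 2 by norm_num, Real.log_pow]; norm_num
    rw [Real.binEntropy, show (1 - 7 / 16 : ℝ) = 9 / 16 by norm_num, inv_div, inv_div,
      Real.log_div (by norm_num) (by norm_num), Real.log_div (by norm_num) (by norm_num), h16, h9]
    ring
  rw [hid]
  linarith [Real.log_two_lt_d9, Real.log_three_gt_d9,
    two_mul_log_two_add_half_log_three_add_le_log_seven'']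

/-- **Upper edge from a checked «c2-sector» sidecar ALONE (infinite-temperature hot anchor), `t–t'` model, every sequence of tori.**
`ω` a torus limit of the canonical sector Gibbs states at `β > 0` along any `Ls → ∞` (`0 ≤ n ≤ 2`); sidecar `rows` for the open `a × b` box
passing `c2Check …` with density `n (q a b) = 2 A₀` and its claim node; and the sector-dimension entropy `s > 2 H_b(n/2)` (eventually
`log #sector_L ≤ s L²`). Then `e_Φ(ω) ≤ (s − Wnum/Wden)/β` — the chord between the certified pressure floor at `β` and the exact pressure
`2 H_b(n/2)` at `β = 0`; no C1 certificate needed (the first thermal cap available in a parameter box without a Markov producer).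
[cite: Israel1979, Lemma II.3.1] [cite: Ruelle1969, §3.4] [cite: CoverThomas2006, Theorem 11.1.3] -/
theorem IsTorusLimitOfMixture.meanEnergy_hubbardTTPrime_le_of_c2Check_infT_allTori
    (hn0 : 0 ≤ n) (hn2 : n ≤ 2)
    (h : ω.IsTorusLimitOfMixture (sectorGibbsCount n) (fun L => sectorGibbsWeightTT' β t t' U n L)
      (fun L => sectorGibbsVectorTT' t t' U n L) Ls)
    (hLs : Tendsto Ls atTop atTop) (hβ : 0 < β)
    {a b : ℕ} (ha : 1 ≤ a) (hb : 1 ≤ b) {rows : List C2Row} {P K q A₀ : ℕ} {Wnum : ℤ} {Wden : ℕ}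
    (hcheck : c2Check P K q A₀ a b rows Wnum Wden = true) (hn : n * ((q : ℝ) * a * b) = 2 * A₀)
    (hnode : ∀ r ∈ rows, r.floor ≤ (partitionFn β (spinSectorHamiltonian r.nu r.nd (hubbardOpenBoxTT' a b t t' U))).re)
    {s : ℝ} (hs : 2 * Real.binEntropy (n / 2) < s) :
    ω.meanEnergy (hubbardTTPrimeFermionInteraction t t' U) 1 ≤ (s - (Wnum : ℝ) / Wden) / β := by
  obtain ⟨hnd, hq, hmS, hsum, hA, hB, hz0, harith⟩ := c2Check_sound hcheck ha hb
  have hz := c2Floor_le_of_rows hnd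
    (F := fun s => (partitionFn β (spinSectorHamiltonian s.1 s.2 (hubbardOpenBoxTT' a b t t' U))).re)
    (fun r hr => hnode r hr)
  set W : ℝ := ((q : ℝ) * Real.log q - ∑ s ∈ c2Sectors rows, (c2Type rows s : ℝ) * Real.log (c2Type rows s) +
    ∑ s ∈ c2Sectors rows, (c2Type rows s : ℝ) * Real.log (c2Floor rows s)) / ((q : ℝ) * a * b) with hW
  -- `e ≤ (s − (W − ε))/β` for every `ε > 0`, hence `e ≤ (s − W)/β ≤ (s − Wnum/Wden)/β`
  have hmain : ω.meanEnergy (hubbardTTPrimeFermionInteraction t t' U) 1 ≤ (s - W) / β := by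
    refine le_of_forall_pos_le_add fun δ hδ => ?_
    have hε : 0 < δ * β := by positivity
    have hfloor := eventually_typeFreeEntropy_mul_sq_le_log_partitionFn_allTori t t' U n hβ.le ha hb
      (c2Sectors rows) (c2Type rows) hq hmS hsum hA hB hn hn2 hz0 hz hLs hε
    have hcount : ∀ᶠ j in atTop, Real.log (sectorGibbsCount n (Ls j)) ≤ s * (Ls j : ℝ) ^ 2 :=
      hLs.eventually (eventually_log_sectorGibbsCount_le hn0 hn2 hs)
    have h1 := h.meanEnergy_hubbardTTPrime_le_entropy_sub_div_of_sectorGibbs hn0 hn2 hLs hβ hfloor hcount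
    rw [← hW] at h1
    have : (s - (W - δ * β)) / β = (s - W) / β + δ := by field_simp; ring
    linarith [this ▸ h1]
  refine hmain.trans (div_le_div_of_nonneg_right ?_ hβ.le)
  linarith

/-- **At filling `7/8`** the entropy constant may be taken `s = 1371/1000` (`2 H_b(7/16) = 1.3706… < 1.371`): with the data of
`…le_of_c2Check_infT_allTori`, `e_Φ(ω) ≤ (1371/1000 − Wnum/Wden)/β` for every torus limit at `n = 7/8`. [cite: Israel1979, Lemma II.3.1]
[cite: Ruelle1969, §3.4] -/
theorem IsTorusLimitOfMixture.meanEnergy_hubbardTTPrime_le_of_c2Check_infT_seven_eighths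
    (h : ω.IsTorusLimitOfMixture (sectorGibbsCount (7 / 8)) (fun L => sectorGibbsWeightTT' β t t' U (7 / 8) L)
      (fun L => sectorGibbsVectorTT' t t' U (7 / 8) L) Ls)
    (hLs : Tendsto Ls atTop atTop) (hβ : 0 < β)
    {a b : ℕ} (ha : 1 ≤ a) (hb : 1 ≤ b) {rows : List C2Row} {P K q A₀ : ℕ} {Wnum : ℤ} {Wden : ℕ}
    (hcheck : c2Check P K q A₀ a b rows Wnum Wden = true) (hn : (7 / 8 : ℝ) * ((q : ℝ) * a * b) = 2 * A₀)
    (hnode : ∀ r ∈ rows, r.floor ≤ (partitionFn β (spinSectorHamiltonian r.nu r.nd (hubbardOpenBoxTT' a b t t' U))).re) :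
    ω.meanEnergy (hubbardTTPrimeFermionInteraction t t' U) 1 ≤ (1371 / 1000 - (Wnum : ℝ) / Wden) / β :=
  h.meanEnergy_hubbardTTPrime_le_of_c2Check_infT_allTori (by norm_num) (by norm_num) hLs hβ ha hb hcheck hn hnode
    two_mul_binEntropy_half_seven_div_eight_lt'

end InfVolFermionState

end Literature.MathematicalPhysics.QuantumLattice

end
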